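import Summits.HodgeConjecture.HodgeConjecture.Theorems.K2E5QuatLocalMeasureDefs           -- ★ #3f: `quatLocal`, `quatLocalUnits(Level)`, `quatLocalLevelTwoP`
import Summits.HodgeConjecture.HodgeConjecture.Theorems.K2E5BetaDetQuasiReflection         -- ★ p855176 (this seat): `exists_mem_level_det_eq`, `conjLocal_inv`, `inv_mem_localIntegers_of_valued_eq_one`
import Summits.HodgeConjecture.HodgeConjecture.Theorems.K2E5BetaDetIndexCalculus           -- ★ p855135 (this seat): `det_mem_localIntegers`, `exists_det_eq_one_add_twoP_mul`
import Summits.HodgeConjecture.HodgeConjecture.Theorems.K2E5QuatLocalNormSurjective        -- ★ (this seat): `exists_mul_conjLocal_eq_of_valued_eq_one`, `exists_mul_conjLocal_eq_of_level`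
import Literature.NumberTheory.Weil1982.UnitaryLocalRingBaseField                          -- ★ `algebraMap_localRing_mem_localIntegers_iff`, `algebraMap_localRing_injective` (+ ★ `QuadraticLocalBaseChange`: `conjLocal_toLocalRing`)
import Literature.NumberTheory.Rogawski1990.SingularLocalRealisation                       -- ★ `exists_toLocalRing_eq_of_conjLocal_eq` (`(c ⊗ 1)`-fixed ⇒ from `L⁺_v`)
import HarnessLib

/-!
# K2 ∕ E5 «TamagawaUnitary», unit H (QUAT-LOCAL) — helper `K2E5QuatLocalDetImage`: **the reduced norm maps the unit group of the local order `Λ_v` ONTO `𝒪_v^×`,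
# and its level-`2p` subgroup ONTO `1 + 2p𝒪_v`** (`v ∤ 2` unramified, `h_v ∈ GL₂(𝒪_{E_v})`)

Cell `hodgecm-mathlib` (Track B «K2-LIT»), floor 0, item h413 = `stmt-HodgeConjecture-24833`; tier-1 socket module `Cruxes/H413/Lines/K2_E5_TamagawaUnitary_QuatLocal.lean`
(K2E5-plan (g0), sha16 0816239b3d4cc124), socket H3 `sig_K2E5QuatLocalGoodPlaceDensity` (p19).  PROOF lane, helper file (`--supports stmt-HodgeConjecture-24833 --as helper`);
author K2E5-p19 (g0).  Part of (W1) of the road of record for H3 (K2/STATUS.md 2026-09-03T23:0xZ): `[Λ_v^× : Λ_v^×(2p)] = [SU(𝒪_v) : K′(2p)] · [𝒪_v^× : 1 + 2p𝒪_v]` along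
`Nrd = det`.  Here: the two `det`-IMAGES, as subgroups of `E_v^×`, with `ι : 𝒪_v → L⁺_v → E_v` (★ `algebraLocalRing`):

* §1 ALGEBRA OF THE MATRIX MODEL `D_v = {x : ᵗ((c⊗1)x)·H_v = H_v·adj x}` (★ #3f `quatLocal`): `det x` is `c ⊗ 1`-fixed for `x ∈ D_v` (`conjLocal_det_eq_det_of_mem_quatLocal`); for
  `g ∈ U(H)(L⁺_v)` and a scalar `λ` with `(c⊗1)λ = λ·det g`, **`λ·g ∈ D_v`** (`smul_mat_mem_quatLocal` — `D_v^× = {λg : det g = σλ∕λ}`).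
* §2 `c ⊗ 1`-FIXED INTEGRAL UNITS COME FROM `𝒪_v^×` (`exists_unitsMap_eq_of_conjLocal_eq`), with the level read off (`… ≡ 1 (2p)` iff the preimage is `≡ 1 (2p)`).
* §3 THE IMAGES: `det(Λ_v^×) = ι(𝒪_v^×)` (`map_det_quatLocalUnitsLevel_eq`) and `det(Λ_v^×(2p)) = ι(1 + 2p𝒪_v)` (`map_det_quatLocalLevelTwoP_eq`): `⊆` by §1–§2; `⊇` — for `t ∈ 𝒪_v^×`
  write `ι t = λ·(c⊗1)λ` (★ `K2E5QuatLocalNormSurjective`, Serre V §2), take `g ∈ U(H)(𝒪_v)` with `det g = (c⊗1)λ ∕ λ` (★ `K2E5BetaDetQuasiReflection.exists_mem_level_det_eq`), then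
  `x = λg ∈ Λ_v^×` has `det x = λ²·det g = ι t`; at level `2p` the same with `λ ≡ 1`, `g ≡ 1 (2p)`.

HONEST LABEL: HC_CM is proved only modulo the 7 printed citations (2 remaining named inputs: hLiu418 = stmt-HodgeConjecture-24832,
h413 = stmt-HodgeConjecture-24833) until rung 0 closes; this helper closes no socket and changes no count.

## References
* [VignerasLNM800] M.-F. Vignéras, *Arithmétique des algèbres de quaternions*, LNM 800 (1980) — Ch. II §2 (`n(𝒪_v^×) = R_v^×` for a maximal order at an unramified place), §4 Lemme 4.6.
* [Serre1979] J.-P. Serre, *Local Fields*, GTM 67 (1979) — Ch. V §2 Prop. 3 and Corollary.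
* [PlatonovRapinchuk1994] V. Platonov, A. Rapinchuk, *Algebraic Groups and Number Theory* (1994) — §1.4.3∕§3.3 (orders in quaternion algebras, congruence subgroups).
-/

set_option autoImplicit false
set_option linter.dupNamespace false

noncomputable section

namespace Summit.HodgeConjecture.HodgeConjecture.Cruxes.H413.K2E5QuatLocalDetImage

open NumberField IsDedekindDomain
open Literature.NumberTheory.Automorphic Literature.NumberTheory.Automorphic.UnitaryGroup
open Literature.NumberTheory.Weil1982.UnitaryFinTopForm
open Summit.HodgeConjecture.HodgeConjecture.Cruxes.H413.K2E5QuatLocalMeasure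
open scoped MatrixGroups Matrix

variable (L : Type) [Field L] [NumberField L] [IsCMField L] (H : Matrix (Fin 2) (Fin 2) L) (v : HeightOneSpectrum (𝓞 ↥(maximalRealSubfield L)))

/-! ## §1 Algebra of the matrix model -/

/-- **`Nrd = det` is `c ⊗ 1`-fixed on `D_v`**: for `x ∈ D_v`, `(c⊗1)(det x) = det x` (take determinants in `ᵗ((c⊗1)x)·H_v = H_v·adj x`, `det adj x = det x` for `2 × 2`, cancel the unit
`det H_v`). [cite: VignerasLNM800, Ch. I §1 (n(x) ∈ K)] -/
theorem conjLocal_det_eq_det_of_mem_quatLocal (hdet : H.det ≠ 0) {x : Matrix (Fin 2) (Fin 2) (LocalRing L v)} (hx : x ∈ quatLocal L H v) :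
    conjLocal L (IsCMField.complexConj L) v x.det = x.det := by
  have h := congrArg Matrix.det ((mem_quatLocal_iff L H v x).1 hx)
  rw [Matrix.det_mul, Matrix.det_mul, Matrix.det_transpose, ← RingHom.mapMatrix_apply, ← RingHom.map_det, Matrix.det_adjugate, Fintype.card_fin,
    show 2 - 1 = 1 from rfl, pow_one, mul_comm (localForm L 2 H v).det] at h
  exact (Literature.NumberTheory.Weil1982.UnitaryFinTopForm.isUnit_det_localForm L 2 H v hdet).mul_right_cancel h

/-- For `g ∈ U(H)(L⁺_v)`: `H_v · adj (mat g) = det (mat g) · ᵗ((c⊗1) mat g) · H_v` (unitarity `ᵗḡ H g = H` times `adj g`, `g · adj g = det g`). [cite: PlatonovRapinchuk1994, §2.3] -/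
theorem localForm_mul_adjugate_mat (g : (cmDatum L 2 H).Local v) :
    localForm L 2 H v * Matrix.adjugate (mat L 2 H v g) =
      (mat L 2 H v g).det • (((mat L 2 H v g).map (conjLocal L (IsCMField.complexConj L) v))ᵀ * localForm L 2 H v) := by
  have hU := transpose_map_mat_mul_localForm_mul_mat L 2 H v g
  have h := congrArg (· * Matrix.adjugate (mat L 2 H v g)) hU
  simp only [Matrix.mul_assoc] at h
  rw [Matrix.mul_adjugate, Matrix.mul_smul, Matrix.mul_one] at h
  rw [← h, Matrix.mul_smul]

/-- **`λ · g ∈ D_v` when `(c⊗1)λ = λ · det g`** (`g ∈ U(H)(L⁺_v)`, `λ ∈ E_v`): `ᵗ((c⊗1)(λg))·H_v = (c⊗1)λ · ᵗḡ H_v` and `H_v·adj(λg) = λ det g · ᵗḡ H_v`.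
[cite: VignerasLNM800, Ch. I §1] [cite: PlatonovRapinchuk1994, §2.3] -/
theorem smul_mat_mem_quatLocal (g : (cmDatum L 2 H).Local v) {lam : LocalRing L v}
    (hlam : conjLocal L (IsCMField.complexConj L) v lam = lam * (mat L 2 H v g).det) :
    lam • mat L 2 H v g ∈ quatLocal L H v := by
  rw [mem_quatLocal_iff, Matrix.map_smul' _ _ _ (map_mul _), Matrix.transpose_smul, Matrix.smul_mul, Matrix.adjugate_smul, Fintype.card_fin,
    show 2 - 1 = 1 from rfl, pow_one, Matrix.mul_smul, localForm_mul_adjugate_mat, smul_smul, hlam]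

/-! ## §2 `c ⊗ 1`-fixed integral units come from `𝒪_v^×` -/

/-- A `c ⊗ 1`-FIXED unit `u` of `E_v` with `u, u⁻¹ ∈ 𝒪_{E_v}` is `ι(t)` for a unit `t ∈ 𝒪_v^×` (★ `exists_toLocalRing_eq_of_conjLocal_eq`, ★ `algebraMap_localRing_mem_localIntegers_iff`).
[cite: PlatonovRapinchuk1994, §5.1] -/
theorem exists_unitsMap_eq_of_conjLocal_eq {u : (LocalRing L v)ˣ} (hσ : conjLocal L (IsCMField.complexConj L) v u = u)
    (hO : (u : LocalRing L v) ∈ localIntegers L v) (hO' : (↑u⁻¹ : LocalRing L v) ∈ localIntegers L v) :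
    ∃ t : (v.adicCompletionIntegers ↥(maximalRealSubfield L))ˣ,
      Units.map (((algebraMap (v.adicCompletion ↥(maximalRealSubfield L)) (LocalRing L v)).comp
        (v.adicCompletionIntegers ↥(maximalRealSubfield L)).subtype).toMonoidHom) t = u := by
  have hσ' : conjLocal L (IsCMField.complexConj L) v ↑u⁻¹ = ↑u⁻¹ := by
    rw [Units.val_inv_eq_inv_val, K2E5BetaDetQuasiReflection.conjLocal_inv, hσ]
  obtain ⟨a, ha⟩ := Literature.NumberTheory.Rogawski1990.exists_toLocalRing_eq_of_conjLocal_eq v hσ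
  obtain ⟨a', ha'⟩ := Literature.NumberTheory.Rogawski1990.exists_toLocalRing_eq_of_conjLocal_eq v hσ'
  change algebraMap _ (LocalRing L v) a = u at ha
  change algebraMap _ (LocalRing L v) a' = ↑u⁻¹ at ha'
  have haO : a ∈ v.adicCompletionIntegers ↥(maximalRealSubfield L) := (algebraMap_localRing_mem_localIntegers_iff L v a).1 (by rw [ha]; exact hO)
  have ha'O : a' ∈ v.adicCompletionIntegers ↥(maximalRealSubfield L) := (algebraMap_localRing_mem_localIntegers_iff L v a').1 (by rw [ha']; exact hO')
  have haa' : a * a' = 1 := algebraMap_localRing_injective L v (by rw [map_mul, map_one, ha, ha', Units.mul_inv])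
  refine ⟨⟨⟨a, haO⟩, ⟨a', ha'O⟩, Subtype.ext haa', Subtype.ext (by rw [mul_comm] at haa'; exact haa')⟩, Units.ext ?_⟩
  exact ha

/-- … and if moreover `u = 1 + 2p·s` with `s ∈ 𝒪_{E_v}`, the preimage satisfies `t ≡ 1 (2p)`, i.e. `t` lies in the kernel of `𝒪_v^× → (𝒪_v ∕ 2p)^×`.
[cite: PlatonovRapinchuk1994, §3.3] -/
theorem unitsMap_preimage_mem_ker {t : (v.adicCompletionIntegers ↥(maximalRealSubfield L))ˣ} {s : LocalRing L v} (hs : s ∈ localIntegers L v)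
    (hts : (algebraMap (v.adicCompletion ↥(maximalRealSubfield L)) (LocalRing L v)) (t : v.adicCompletionIntegers ↥(maximalRealSubfield L)) = 1 + twoP L v * s) :
    t ∈ (Units.map (Ideal.Quotient.mk (Ideal.span {((2 * resChar L v : ℕ) : v.adicCompletionIntegers ↥(maximalRealSubfield L))})).toMonoidHom).ker := by
  -- `s` is `c ⊗ 1`-fixed, hence `s = ι s₀` with `s₀ ∈ 𝒪_v`
  have h2pu : IsUnit (twoP L v) := isUnit_twoP L v
  have hσs : conjLocal L (IsCMField.complexConj L) v s = s := by
    have e : s = ↑h2pu.unit⁻¹ * ((algebraMap (v.adicCompletion ↥(maximalRealSubfield L)) (LocalRing L v)) (t : v.adicCompletionIntegers ↥(maximalRealSubfield L)) - 1) := by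
      rw [hts, add_sub_cancel_left, ← mul_assoc, IsUnit.val_inv_mul, one_mul]
    have hσ2 : conjLocal L (IsCMField.complexConj L) v (↑h2pu.unit⁻¹ : LocalRing L v) = ↑h2pu.unit⁻¹ := by
      rw [Units.val_inv_eq_inv_val, K2E5BetaDetQuasiReflection.conjLocal_inv, IsUnit.unit_spec, twoP, map_natCast]
    rw [e, map_mul, hσ2, map_sub, map_one]
    congr 2
    exact conjLocal_toLocalRing (IsCMField.complexConj L) v _
  obtain ⟨s₀, hs₀⟩ := Literature.NumberTheory.Rogawski1990.exists_toLocalRing_eq_of_conjLocal_eq v hσs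
  change algebraMap _ (LocalRing L v) s₀ = s at hs₀
  have hs₀O : s₀ ∈ v.adicCompletionIntegers ↥(maximalRealSubfield L) := (algebraMap_localRing_mem_localIntegers_iff L v s₀).1 (by rw [hs₀]; exact hs)
  rw [MonoidHom.mem_ker]
  apply Units.ext
  simp only [Units.coe_map, Units.val_one]
  change Ideal.Quotient.mk _ (t : v.adicCompletionIntegers ↥(maximalRealSubfield L)) = 1
  rw [← (Ideal.Quotient.mk _).map_one, Ideal.Quotient.eq, Ideal.mem_span_singleton']
  refine ⟨⟨s₀, hs₀O⟩, ?_⟩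
  -- read the identity in `E_v` through the injective `ι`
  have hι : Function.Injective ((algebraMap (v.adicCompletion ↥(maximalRealSubfield L)) (LocalRing L v)).comp
      (v.adicCompletionIntegers ↥(maximalRealSubfield L)).subtype) :=
    (algebraMap_localRing_injective L v).comp Subtype.val_injective
  apply hι
  rw [map_mul, map_natCast, map_sub, map_one]
  have e1 : ((algebraMap (v.adicCompletion ↥(maximalRealSubfield L)) (LocalRing L v)).comp (v.adicCompletionIntegers ↥(maximalRealSubfield L)).subtype)
      ⟨s₀, hs₀O⟩ = s := hs₀
  have e2 : ((algebraMap (v.adicCompletion ↥(maximalRealSubfield L)) (LocalRing L v)).comp (v.adicCompletionIntegers ↥(maximalRealSubfield L)).subtype)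
      (t : v.adicCompletionIntegers ↥(maximalRealSubfield L)) = 1 + twoP L v * s := hts
  rw [e1, e2, add_sub_cancel_left, twoP, mul_comm]

/-! ## §3 The two `det`-images -/

/-- CORE OF `⊇`: from `u = λ·(c⊗1)λ` with `u, u⁻¹` `c⊗1`-fixed integral and `λ ∈ 𝒪_{E_v}`, an element `x ∈ Λ_v^×` with `det x = u` — namely `x = λ·g` for a `g ∈ U(H)(𝒪_v)` with
`det g = (c⊗1)λ∕λ` (★ `exists_mem_level_det_eq`); and `x ∈ Λ_v^×(2p)` when `λ ≡ 1 ≡ u (2p)`. [cite: VignerasLNM800, Ch. II §2] [cite: PlatonovRapinchuk1994, §2.3, §3.3] -/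
theorem exists_mem_unitsLevel_det_eq (hherm : (H.map (cmConjRingHom L))ᵀ = H) (hdet : H.det ≠ 0) (h2 : (2 : 𝓞 ↥(maximalRealSubfield L)) ∉ v.asIdeal)
    (hF : localForm L 2 H v ∈ intMatrices L 2 v) (hF' : (localForm L 2 H v)⁻¹ ∈ intMatrices L 2 v)
    {u ui lam : LocalRing L v} (huu : u * ui = 1) (hσui : conjLocal L (IsCMField.complexConj L) v ui = ui)
    (huiO : ui ∈ localIntegers L v) (hlamO : lam ∈ localIntegers L v) (hlam : lam * conjLocal L (IsCMField.complexConj L) v lam = u) :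
    ∃ x : GL (Fin 2) (LocalRing L v), x ∈ quatLocalUnitsLevel L H v ∧ (x.val).det = u ∧
      ((∃ r ∈ localIntegers L v, lam = 1 + twoP L v * r) → (∃ r₀ ∈ localIntegers L v, u = 1 + twoP L v * r₀) → x ∈ quatLocalLevelTwoP L H v) := by
  set σ := conjLocal L (IsCMField.complexConj L) v with hσdef
  have hσσ : ∀ z, σ (σ z) = z := conjLocal_conjLocal L v
  -- `λ' = σλ·u⁻¹` is the inverse of `λ`; `μ = σλ·λ'` is the prescribed norm-one determinant
  set lam' : LocalRing L v := σ lam * ui with hlam'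
  set μ : LocalRing L v := σ lam * lam' with hμ
  have hll' : lam * lam' = 1 := by rw [hlam', ← mul_assoc, hlam, huu]
  have hσlamO : σ lam ∈ localIntegers L v := conjLocal_mem_localIntegers L v hlamO
  have hlam'O : lam' ∈ localIntegers L v := mul_mem hσlamO huiO
  have hμO : μ ∈ localIntegers L v := mul_mem hσlamO hlam'O
  have hσμ : σ μ * μ = 1 := by
    have e : σ μ * μ = ((lam * σ lam) * ui) ^ 2 := by
      rw [hμ, hlam', map_mul, map_mul, hσσ, hσui]; ring
    rw [e, hlam, huu, one_pow]
  have hlamμ : σ lam = lam * μ := by rw [hμ, ← mul_assoc, mul_comm lam, mul_assoc, hll', mul_one]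
  obtain ⟨g, hg, hgdet, hglev⟩ := K2E5BetaDetQuasiReflection.exists_mem_level_det_eq L H v hherm hdet h2 hF hF' hμO hσμ
  obtain ⟨hgi, hgi'⟩ := (mem_cmLocalIntegralLevel_iff_mat L 2 H v g).1 hg
  -- the `GL` element `x = λ·g`
  have hinv1 : (lam • mat L 2 H v g) * (lam' • mat L 2 H v g⁻¹) = 1 := by
    rw [Matrix.smul_mul, Matrix.mul_smul, smul_smul, mat_mul_inv, hll', one_smul]
  have hinv2 : (lam' • mat L 2 H v g⁻¹) * (lam • mat L 2 H v g) = 1 := by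
    rw [Matrix.smul_mul, Matrix.mul_smul, smul_smul, mat_inv_mul, mul_comm, hll', one_smul]
  let x : GL (Fin 2) (LocalRing L v) := ⟨lam • mat L 2 H v g, lam' • mat L 2 H v g⁻¹, hinv1, hinv2⟩
  have hxD : x.val ∈ quatLocal L H v := smul_mat_mem_quatLocal L H v g (by rw [hgdet]; exact hlamμ)
  refine ⟨x, ⟨(mem_quatLocalUnits_iff L H v x).2 hxD, smul_mem_intMatrices L 2 v hlamO hgi, smul_mem_intMatrices L 2 v hlam'O hgi'⟩, ?_, ?_⟩
  · show (lam • mat L 2 H v g).det = u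
    rw [Matrix.det_smul, Fintype.card_fin, hgdet, pow_two, mul_assoc, ← hlamμ, hlam]
  · rintro ⟨r, hr, hlr⟩ ⟨r₀, hr₀, hur₀⟩
    -- `μ ≡ 1`, hence `g ∈ K_U(2p)`; `λ ≡ 1`, `λ' ≡ 1`
    have h2p : σ (twoP L v) = twoP L v := by rw [twoP, map_natCast]
    have hσlam : σ lam = 1 + twoP L v * σ r := by rw [hlr, map_add, map_one, map_mul, h2p]
    have hlam'1 : lam' = 1 + twoP L v * ((σ r - r₀) * ui) := by
      have e : lam' = σ lam * ui - u * ui + 1 := by rw [hlam', huu]; ring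
      rw [e, hσlam, hur₀]; ring
    have hμ1 : μ = 1 + twoP L v * (σ r + (σ r - r₀) * ui + twoP L v * (σ r * ((σ r - r₀) * ui))) := by
      rw [hμ, hσlam, hlam'1]; ring
    have hσrO : σ r ∈ localIntegers L v := conjLocal_mem_localIntegers L v hr
    have h2pO : twoP L v ∈ localIntegers L v := by rw [twoP]; exact natCast_mem _ _
    have hglev' := hglev ⟨_, add_mem (add_mem hσrO (mul_mem (sub_mem hσrO hr₀) huiO)) (mul_mem h2pO (mul_mem hσrO (mul_mem (sub_mem hσrO hr₀) huiO))), hμ1⟩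
    obtain ⟨hg1, hg2⟩ := (mem_levelTwoP_one_iff L 2 H v g).1 hglev'
    have key : ∀ (a t : LocalRing L v) (M : Matrix (Fin 2) (Fin 2) (LocalRing L v)), t ∈ localIntegers L v → a = 1 + twoP L v * t → M ∈ intMatrices L 2 v →
        M - 1 ∈ twoPIntMatrices L 2 v → a • M - 1 ∈ twoPIntMatrices L 2 v := by
      intro a t M ht hat hM hM1
      have e : a • M - 1 = twoP L v • (t • M) + (M - 1) := by rw [hat, add_smul, one_smul, smul_smul]; abel
      rw [e]
      exact add_mem ((mem_twoPIntMatrices_iff L 2 v _).2 ⟨t • M, smul_mem_intMatrices L 2 v ht hM, rfl⟩) hM1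
    exact ⟨(mem_quatLocalUnits_iff L H v x).2 hxD, key lam r _ hr hlr hgi hg1, key lam' _ _ (mul_mem (sub_mem hσrO hr₀) huiO) hlam'1 hgi' hg2⟩

/-- **`det(Λ_v^×) = ι(𝒪_v^×)`** as subgroups of `E_v^×` (`v` unramified in `L`, `v ∤ 2`, `H` hermitian with `det H ≠ 0`, `H_v, H_v⁻¹ ∈ M₂(𝒪_{E_v})`).
[cite: VignerasLNM800, Ch. II §2, §4 Lemme 4.6] [cite: Serre1979, Ch. V §2 Corollary] -/
theorem map_det_quatLocalUnitsLevel_eq (hherm : (H.map (cmConjRingHom L))ᵀ = H) (hdet : H.det ≠ 0) (h2 : (2 : 𝓞 ↥(maximalRealSubfield L)) ∉ v.asIdeal)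
    (hv : Algebra.IsUnramifiedIn (𝓞 L) v.asIdeal) (hF : localForm L 2 H v ∈ intMatrices L 2 v) (hF' : (localForm L 2 H v)⁻¹ ∈ intMatrices L 2 v) :
    (quatLocalUnitsLevel L H v).map (Matrix.GeneralLinearGroup.det : GL (Fin 2) (LocalRing L v) →* (LocalRing L v)ˣ) =
      (Units.map (((algebraMap (v.adicCompletion ↥(maximalRealSubfield L)) (LocalRing L v)).comp
        (v.adicCompletionIntegers ↥(maximalRealSubfield L)).subtype).toMonoidHom)).range := by
  refine le_antisymm ?_ ?_
  · rintro _ ⟨x, hx, rfl⟩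
    obtain ⟨hxU, hxi, hxi'⟩ := (mem_quatLocalUnitsLevel_iff L H v x).1 hx
    have hσ : conjLocal L (IsCMField.complexConj L) v ↑(Matrix.GeneralLinearGroup.det x) = ↑(Matrix.GeneralLinearGroup.det x) :=
      conjLocal_det_eq_det_of_mem_quatLocal L H v hdet ((mem_quatLocalUnits_iff L H v x).1 hxU)
    have hO : (↑(Matrix.GeneralLinearGroup.det x) : LocalRing L v) ∈ localIntegers L v := K2E5BetaDetIndexCalculus.det_mem_localIntegers L 2 v hxi
    have hO' : (↑(Matrix.GeneralLinearGroup.det x)⁻¹ : LocalRing L v) ∈ localIntegers L v := by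
      rw [← map_inv]; exact K2E5BetaDetIndexCalculus.det_mem_localIntegers L 2 v hxi'
    obtain ⟨t, ht⟩ := exists_unitsMap_eq_of_conjLocal_eq L v hσ hO hO'
    exact ⟨t, ht⟩
  · rintro _ ⟨t, rfl⟩
    set u : LocalRing L v := (algebraMap (v.adicCompletion ↥(maximalRealSubfield L)) (LocalRing L v)) (t : v.adicCompletionIntegers ↥(maximalRealSubfield L)) with hu
    set ui : LocalRing L v := (algebraMap (v.adicCompletion ↥(maximalRealSubfield L)) (LocalRing L v)) ((t⁻¹ : (v.adicCompletionIntegers ↥(maximalRealSubfield L))ˣ) : v.adicCompletionIntegers ↥(maximalRealSubfield L)) with hui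
    have huu : u * ui = 1 := by rw [hu, hui, ← map_mul, ← Subring.coe_mul, ← Units.val_mul, mul_inv_cancel, Units.val_one, Subring.coe_one, map_one]
    have hσu : conjLocal L (IsCMField.complexConj L) v u = u := conjLocal_toLocalRing (IsCMField.complexConj L) v _
    have hσui : conjLocal L (IsCMField.complexConj L) v ui = ui := conjLocal_toLocalRing (IsCMField.complexConj L) v _
    have huO : u ∈ localIntegers L v := (algebraMap_localRing_mem_localIntegers_iff L v _).2 (SetLike.coe_mem _)
    have huiO : ui ∈ localIntegers L v := (algebraMap_localRing_mem_localIntegers_iff L v _).2 (SetLike.coe_mem _)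
    have hval : ∀ w : PlacesOver L v, Valued.v (u w) = 1 := by
      intro w
      have h1 := (mem_integer_iff_valued_le_one L v w _).1 ((mem_localIntegers_iff L v _).1 huO w)
      have h2 := (mem_integer_iff_valued_le_one L v w _).1 ((mem_localIntegers_iff L v _).1 huiO w)
      have hprod : Valued.v (u w) * Valued.v (ui w) = 1 := by rw [← map_mul, ← Pi.mul_apply, huu, Pi.one_apply, map_one]
      refine le_antisymm h1 (not_lt.1 fun hlt => ?_)
      have : Valued.v (u w) * Valued.v (ui w) < 1 := mul_lt_one_of_lt_of_le hlt h2
      rw [hprod] at this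
      exact lt_irrefl _ this
    obtain ⟨lam, hlamv, hlam⟩ := K2E5QuatLocalNormSurjective.exists_mul_conjLocal_eq_of_valued_eq_one L v hv hσu hval
    have hlamO : lam ∈ localIntegers L v := (mem_localIntegers_iff L v _).2 fun w => (mem_integer_iff_valued_le_one L v w _).2 (hlamv w).le
    obtain ⟨x, hx, hxdet, -⟩ := exists_mem_unitsLevel_det_eq L H v hherm hdet h2 hF hF' huu hσui huiO hlamO hlam
    exact ⟨x, hx, Units.ext hxdet⟩

/-- **`det(Λ_v^×(2p)) = ι(1 + 2p𝒪_v)`** as subgroups of `E_v^×` (same hypotheses): `⊆` — `x ≡ 1 (2p)` forces `det x ≡ 1 (2p)` and the preimage in `𝒪_v^×` is `≡ 1 (2p)`; `⊇` — Serre V §2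
Prop. 3 a) at level `2p` (★ `exists_mul_conjLocal_eq_of_level`) and the level clause of §3's core. [cite: Serre1979, Ch. V §2 Prop. 3 a)] [cite: PlatonovRapinchuk1994, §3.3] -/
theorem map_det_quatLocalLevelTwoP_eq (hherm : (H.map (cmConjRingHom L))ᵀ = H) (hdet : H.det ≠ 0) (h2 : (2 : 𝓞 ↥(maximalRealSubfield L)) ∉ v.asIdeal)
    (hv : Algebra.IsUnramifiedIn (𝓞 L) v.asIdeal) (hF : localForm L 2 H v ∈ intMatrices L 2 v) (hF' : (localForm L 2 H v)⁻¹ ∈ intMatrices L 2 v) :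
    (quatLocalLevelTwoP L H v).map (Matrix.GeneralLinearGroup.det : GL (Fin 2) (LocalRing L v) →* (LocalRing L v)ˣ) =
      ((Units.map (Ideal.Quotient.mk (Ideal.span {((2 * resChar L v : ℕ) : v.adicCompletionIntegers ↥(maximalRealSubfield L))})).toMonoidHom).ker).map
        (Units.map (((algebraMap (v.adicCompletion ↥(maximalRealSubfield L)) (LocalRing L v)).comp
          (v.adicCompletionIntegers ↥(maximalRealSubfield L)).subtype).toMonoidHom)) := by
  refine le_antisymm ?_ ?_
  · rintro _ ⟨x, hx, rfl⟩
    obtain ⟨hxU, hx1, hx2⟩ := (mem_quatLocalLevelTwoP_iff L H v x).1 hx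
    have hxL := quatLocalLevelTwoP_le_quatLocalUnitsLevel L H v hx
    obtain ⟨-, hxi, hxi'⟩ := (mem_quatLocalUnitsLevel_iff L H v x).1 hxL
    have hσ : conjLocal L (IsCMField.complexConj L) v ↑(Matrix.GeneralLinearGroup.det x) = ↑(Matrix.GeneralLinearGroup.det x) :=
      conjLocal_det_eq_det_of_mem_quatLocal L H v hdet ((mem_quatLocalUnits_iff L H v x).1 hxU)
    have hO : (↑(Matrix.GeneralLinearGroup.det x) : LocalRing L v) ∈ localIntegers L v := K2E5BetaDetIndexCalculus.det_mem_localIntegers L 2 v hxi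
    have hO' : (↑(Matrix.GeneralLinearGroup.det x)⁻¹ : LocalRing L v) ∈ localIntegers L v := by
      rw [← map_inv]; exact K2E5BetaDetIndexCalculus.det_mem_localIntegers L 2 v hxi'
    obtain ⟨t, ht⟩ := exists_unitsMap_eq_of_conjLocal_eq L v hσ hO hO'
    obtain ⟨s, hs, hds⟩ := K2E5BetaDetIndexCalculus.exists_det_eq_one_add_twoP_mul L v hx1
    refine ⟨t, ?_, ht⟩
    refine unitsMap_preimage_mem_ker L v hs ?_
    have h := congrArg Units.val ht
    exact h.trans hds
  · rintro _ ⟨t, ht, rfl⟩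
    rw [SetLike.mem_coe, MonoidHom.mem_ker] at ht
    have ht1 : ((t : v.adicCompletionIntegers ↥(maximalRealSubfield L)) : v.adicCompletionIntegers ↥(maximalRealSubfield L)) - 1 ∈
        Ideal.span {((2 * resChar L v : ℕ) : v.adicCompletionIntegers ↥(maximalRealSubfield L))} := by
      rw [← Ideal.Quotient.eq, map_one]
      have h := congrArg Units.val ht
      simpa using h
    obtain ⟨r₀, hr₀⟩ := Ideal.mem_span_singleton'.1 ht1
    set u : LocalRing L v := (algebraMap (v.adicCompletion ↥(maximalRealSubfield L)) (LocalRing L v)) (t : v.adicCompletionIntegers ↥(maximalRealSubfield L)) with hu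
    set ui : LocalRing L v := (algebraMap (v.adicCompletion ↥(maximalRealSubfield L)) (LocalRing L v)) ((t⁻¹ : (v.adicCompletionIntegers ↥(maximalRealSubfield L))ˣ) : v.adicCompletionIntegers ↥(maximalRealSubfield L)) with hui
    have huu : u * ui = 1 := by rw [hu, hui, ← map_mul, ← Subring.coe_mul, ← Units.val_mul, mul_inv_cancel, Units.val_one, Subring.coe_one, map_one]
    have hσu : conjLocal L (IsCMField.complexConj L) v u = u := conjLocal_toLocalRing (IsCMField.complexConj L) v _
    have hσui : conjLocal L (IsCMField.complexConj L) v ui = ui := conjLocal_toLocalRing (IsCMField.complexConj L) v _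
    have huO : u ∈ localIntegers L v := (algebraMap_localRing_mem_localIntegers_iff L v _).2 (SetLike.coe_mem _)
    have huiO : ui ∈ localIntegers L v := (algebraMap_localRing_mem_localIntegers_iff L v _).2 (SetLike.coe_mem _)
    -- `u = 1 + 2p · ι r₀`
    set r : LocalRing L v := (algebraMap (v.adicCompletion ↥(maximalRealSubfield L)) (LocalRing L v)) (r₀ : v.adicCompletionIntegers ↥(maximalRealSubfield L)) with hr
    have hrO : r ∈ localIntegers L v := (algebraMap_localRing_mem_localIntegers_iff L v _).2 (SetLike.coe_mem _)
    have hur : u = 1 + twoP L v * r := by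
      have h := congrArg ((algebraMap (v.adicCompletion ↥(maximalRealSubfield L)) (LocalRing L v)).comp (v.adicCompletionIntegers ↥(maximalRealSubfield L)).subtype) hr₀
      rw [map_mul, map_sub, map_one, map_natCast] at h
      have h' : r * twoP L v = u - 1 := h
      rw [← sub_eq_iff_eq_add', ← h', mul_comm]
    obtain ⟨lam, r', hr', hlr, hlam⟩ := K2E5QuatLocalNormSurjective.exists_mul_conjLocal_eq_of_level L v hv hσu hrO hur
    have hlamO : lam ∈ localIntegers L v := by
      rw [hlr]; exact add_mem (one_mem _) (mul_mem (by rw [twoP]; exact natCast_mem _ _) hr')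
    obtain ⟨x, hx, hxdet, hxlev⟩ := exists_mem_unitsLevel_det_eq L H v hherm hdet h2 hF hF' huu hσui huiO hlamO hlam
    exact ⟨x, hxlev ⟨r', hr', hlr⟩ ⟨r, hrO, hur⟩, Units.ext hxdet⟩

end Summit.HodgeConjecture.HodgeConjecture.Cruxes.H413.K2E5QuatLocalDetImage

end
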